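import Summits.Ventures.PercRepro.Night2GoodTwoD2Shape

/-!
# night-2: no distance-1 load at a distance-2 target

In the shape `T ∖ K = R ∪ {wₐ, p₁} ∪ {w_b, p₂} ∪ {w_c}` of a distance-2 target (`d2Target_shape`), every line other
than `clF R` carries at most three points of `T ∖ K` (`card_le_three_of_rkN_le_two_of_shape`): two points of one pair
span a line inside two of the hyperplanes, which then misses the other pair and `w_c`; a point of each pair spans a
line inside the third hyperplane, which misses `w_c`.  Deleting one point of `T ∖ K` therefore leaves a rank-`5` set
with at most two coloops — three would leave `|R| + 1 ≥ 4` points of rank `2` off `R` — so no thin pair `(B', z')` with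
`insert z' B' = T.erase y` is lossy: `dshGT` sends nothing to `T`, and the whole `dshGT2` load of `T` is its
distance-2 part.
-/

namespace PercRepro.Shadow

open PercRepro.ThmH PercRepro.PerFlat

variable {α : Type*} [DecidableEq α] {M : Matroid α} [M.Finite] {G : Finset α}

/-- Two distinct points span a line containing every rank-`2` set through them. -/
theorem subset_clF_pair_of_rkN_le_two (hs : ∀ e ∈ gr M, ∀ f ∈ gr M, e ≠ f → rkN M {e, f} = 2)
    {Z : Finset α} (hZg : Z ⊆ gr M) (hZ : rkN M Z ≤ 2) {u v : α} (hu : u ∈ Z) (hv : v ∈ Z) (huv : u ≠ v) :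
    Z ⊆ clF M {u, v} := by
  have hpair : ({u, v} : Finset α) ⊆ Z := by
    intro a ha
    rw [Finset.mem_insert, Finset.mem_singleton] at ha
    rcases ha with rfl | rfl
    · exact hu
    · exact hv
  have h2 := hs u (hZg hu) v (hZg hv) huv
  have hle := rkN_mono (M := M) hpair
  intro a ha
  exact mem_clF_of_rkN_eq hpair hZg (by omega) ha

/-- **The line bound of the shape**: a subset of `T' = R ∪ {wₐ, p₁, w_b, p₂, w_c}` of rank `≤ 2` not inside `R` has at
most three points. -/
theorem card_le_three_of_rkN_le_two_of_shape (hs : ∀ e ∈ gr M, ∀ f ∈ gr M, e ≠ f → rkN M {e, f} = 2)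
    {R : Finset α} {wa wb wc p1 p2 : α} (hRg : R ⊆ gr M) (hwag : wa ∈ gr M) (hwbg : wb ∈ gr M)
    (hwcg : wc ∈ gr M) (hp1g : p1 ∈ gr M) (hp2g : p2 ∈ gr M)
    (hwaR : wa ∉ R) (hwbR : wb ∉ R) (hwcR : wc ∉ R) (hab : wa ≠ wb) (hac : wa ≠ wc) (hbc : wb ≠ wc)
    (hp1 : p1 ∉ R ∪ {wa, wb, wc}) (hp2 : p2 ∉ R ∪ {wa, wb, wc}) (hp12 : p1 ≠ p2)
    (hwaH : wa ∉ clF M (R ∪ {wb, wc})) (hwbH : wb ∉ clF M (R ∪ {wa, wc})) (hwcH : wc ∉ clF M (R ∪ {wa, wb}))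
    (hp1a : p1 ∉ clF M (R ∪ {wb, wc})) (hp1b : p1 ∈ clF M (R ∪ {wa, wc})) (hp1c : p1 ∈ clF M (R ∪ {wa, wb}))
    (hp2b : p2 ∉ clF M (R ∪ {wa, wc})) (hp2a : p2 ∈ clF M (R ∪ {wb, wc})) (hp2c : p2 ∈ clF M (R ∪ {wa, wb}))
    {Z : Finset α} (hZT : Z ⊆ insert p1 (insert p2 (R ∪ {wa, wb, wc}))) (hZ : rkN M Z ≤ 2)
    (hZR : ¬ Z ⊆ R) : Z.card ≤ 3 := by
  have hTg : insert p1 (insert p2 (R ∪ {wa, wb, wc})) ⊆ gr M := by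
    intro a ha
    simp only [Finset.mem_insert, Finset.mem_union, Finset.mem_singleton] at ha
    rcases ha with rfl | rfl | h | rfl | rfl | rfl
    · exact hp1g
    · exact hp2g
    · exact hRg h
    · exact hwag
    · exact hwbg
    · exact hwcg
  have hZg : Z ⊆ gr M := hZT.trans hTg
  simp only [Finset.mem_union, Finset.mem_insert, Finset.mem_singleton, not_or] at hp1 hp2
  -- memberships of the five points in the three hyperplanes
  have hsubA : R ∪ {wb, wc} ⊆ clF M (R ∪ {wb, wc}) :=
    fun a ha => subset_clF_of_subset_gr (Finset.union_subset hRg (by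
      intro b hb; rw [Finset.mem_insert, Finset.mem_singleton] at hb
      rcases hb with rfl | rfl; exacts [hwbg, hwcg])) ha
  have hsubB : R ∪ {wa, wc} ⊆ clF M (R ∪ {wa, wc}) :=
    fun a ha => subset_clF_of_subset_gr (Finset.union_subset hRg (by
      intro b hb; rw [Finset.mem_insert, Finset.mem_singleton] at hb
      rcases hb with rfl | rfl; exacts [hwag, hwcg])) ha
  have hsubC : R ∪ {wa, wb} ⊆ clF M (R ∪ {wa, wb}) :=
    fun a ha => subset_clF_of_subset_gr (Finset.union_subset hRg (by
      intro b hb; rw [Finset.mem_insert, Finset.mem_singleton] at hb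
      rcases hb with rfl | rfl; exacts [hwag, hwbg])) ha
  have hwaB : wa ∈ clF M (R ∪ {wa, wc}) := hsubB (by simp)
  have hwaC : wa ∈ clF M (R ∪ {wa, wb}) := hsubC (by simp)
  have hwbA : wb ∈ clF M (R ∪ {wb, wc}) := hsubA (by simp)
  have hwbC : wb ∈ clF M (R ∪ {wa, wb}) := hsubC (by simp)
  -- points of `T'` in `clF R` lie in `R`
  have hclR : ∀ x ∈ insert p1 (insert p2 (R ∪ {wa, wb, wc})), x ∈ clF M R → x ∈ R := by
    intro x hx hxR
    simp only [Finset.mem_insert, Finset.mem_union, Finset.mem_singleton] at hx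
    rcases hx with rfl | rfl | h | rfl | rfl | rfl
    · exact absurd (clF_mono Finset.subset_union_left hxR) hp1a
    · exact absurd (clF_mono Finset.subset_union_left hxR) hp2b
    · exact h
    · exact absurd (clF_mono Finset.subset_union_left hxR) hwaH
    · exact absurd (clF_mono Finset.subset_union_left hxR) hwbH
    · exact absurd (clF_mono Finset.subset_union_left hxR) hwcH
  -- Claim A: at most one point of `Z` in `R`
  have hA : (Z ∩ R).card ≤ 1 := by
    rw [Finset.card_le_one]
    intro a ha b hb
    by_contra hne
    rw [Finset.mem_inter] at ha hb
    have hsub := subset_clF_pair_of_rkN_le_two hs hZg hZ ha.1 hb.1 hne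
    have hsub' : Z ⊆ clF M R := hsub.trans (clF_subset_clF_of_subset_clF (by
      intro x hx
      rw [Finset.mem_insert, Finset.mem_singleton] at hx
      rcases hx with rfl | rfl
      · exact subset_clF_of_subset_gr hRg ha.2
      · exact subset_clF_of_subset_gr hRg hb.2))
    exact hZR fun x hx => hclR x (hZT hx) (hsub' hx)
  -- Claim B: at most two of the five named points
  have hB : (Z ∩ {wa, p1, wb, p2, wc}).card ≤ 2 := by
    by_cases h1 : wa ∈ Z ∧ p1 ∈ Z
    · -- `Z ⊆ clF {wa, p1} ⊆ H_b ∩ H_c`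
      have hsub := subset_clF_pair_of_rkN_le_two hs hZg hZ h1.1 h1.2 (fun h => hp1.2.1 h.symm)
      have hZb : Z ⊆ clF M (R ∪ {wa, wc}) := hsub.trans (clF_subset_clF_of_subset_clF (by
        intro x hx; rw [Finset.mem_insert, Finset.mem_singleton] at hx
        rcases hx with rfl | rfl; exacts [hwaB, hp1b]))
      have hZc : Z ⊆ clF M (R ∪ {wa, wb}) := hsub.trans (clF_subset_clF_of_subset_clF (by
        intro x hx; rw [Finset.mem_insert, Finset.mem_singleton] at hx
        rcases hx with rfl | rfl; exacts [hwaC, hp1c]))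
      have : Z ∩ {wa, p1, wb, p2, wc} ⊆ {wa, p1} := by
        intro x hx
        rw [Finset.mem_inter] at hx
        simp only [Finset.mem_insert, Finset.mem_singleton] at hx ⊢
        rcases hx.2 with rfl | rfl | rfl | rfl | rfl
        · exact Or.inl rfl
        · exact Or.inr rfl
        · exact absurd (hZb hx.1) hwbH
        · exact absurd (hZb hx.1) hp2b
        · exact absurd (hZc hx.1) hwcH
      exact (Finset.card_le_card this).trans (Finset.card_le_two)
    by_cases h2 : wb ∈ Z ∧ p2 ∈ Z
    · have hsub := subset_clF_pair_of_rkN_le_two hs hZg hZ h2.1 h2.2 (fun h => hp2.2.2.1 h.symm)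
      have hZa : Z ⊆ clF M (R ∪ {wb, wc}) := hsub.trans (clF_subset_clF_of_subset_clF (by
        intro x hx; rw [Finset.mem_insert, Finset.mem_singleton] at hx
        rcases hx with rfl | rfl; exacts [hwbA, hp2a]))
      have hZc : Z ⊆ clF M (R ∪ {wa, wb}) := hsub.trans (clF_subset_clF_of_subset_clF (by
        intro x hx; rw [Finset.mem_insert, Finset.mem_singleton] at hx
        rcases hx with rfl | rfl; exacts [hwbC, hp2c]))
      have : Z ∩ {wa, p1, wb, p2, wc} ⊆ {wb, p2} := by
        intro x hx
        rw [Finset.mem_inter] at hx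
        simp only [Finset.mem_insert, Finset.mem_singleton] at hx ⊢
        rcases hx.2 with rfl | rfl | rfl | rfl | rfl
        · exact absurd (hZa hx.1) hwaH
        · exact absurd (hZa hx.1) hp1a
        · exact Or.inl rfl
        · exact Or.inr rfl
        · exact absurd (hZc hx.1) hwcH
      exact (Finset.card_le_card this).trans (Finset.card_le_two)
    -- neither pair is fully in `Z`
    have ha1 : (Z ∩ {wa, p1}).card ≤ 1 := by
      rw [Finset.card_le_one]
      intro a ha b hb
      rw [Finset.mem_inter, Finset.mem_insert, Finset.mem_singleton] at ha hb
      by_contra hne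
      apply h1
      rcases ha.2 with rfl | rfl <;> rcases hb.2 with rfl | rfl
      · exact absurd rfl hne
      · exact ⟨ha.1, hb.1⟩
      · exact ⟨hb.1, ha.1⟩
      · exact absurd rfl hne
    have hb1 : (Z ∩ {wb, p2}).card ≤ 1 := by
      rw [Finset.card_le_one]
      intro a ha b hb
      rw [Finset.mem_inter, Finset.mem_insert, Finset.mem_singleton] at ha hb
      by_contra hne
      apply h2
      rcases ha.2 with rfl | rfl <;> rcases hb.2 with rfl | rfl
      · exact absurd rfl hne
      · exact ⟨ha.1, hb.1⟩
      · exact ⟨hb.1, ha.1⟩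
      · exact absurd rfl hne
    have hunion : Z ∩ {wa, p1, wb, p2, wc} ⊆ (Z ∩ {wa, p1}) ∪ (Z ∩ {wb, p2}) ∪ (Z ∩ {wc}) := by
      intro x hx
      rw [Finset.mem_inter] at hx
      simp only [Finset.mem_union, Finset.mem_inter, Finset.mem_insert, Finset.mem_singleton] at hx ⊢
      rcases hx.2 with rfl | rfl | rfl | rfl | rfl
      · exact Or.inl (Or.inl ⟨hx.1, Or.inl rfl⟩)
      · exact Or.inl (Or.inl ⟨hx.1, Or.inr rfl⟩)
      · exact Or.inl (Or.inr ⟨hx.1, Or.inl rfl⟩)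
      · exact Or.inl (Or.inr ⟨hx.1, Or.inr rfl⟩)
      · exact Or.inr ⟨hx.1, rfl⟩
    have hcu := Finset.card_le_card hunion
    have hcu2 := Finset.card_union_le ((Z ∩ {wa, p1}) ∪ (Z ∩ {wb, p2})) (Z ∩ {wc})
    have hcu3 := Finset.card_union_le (Z ∩ {wa, p1}) (Z ∩ {wb, p2})
    by_cases hwc : wc ∈ Z
    · -- `w_c ∈ Z`: not both pairs are hit
      have hc1 : (Z ∩ {wc}).card ≤ 1 := (Finset.card_le_card Finset.inter_subset_right).trans (by simp)
      have hnot : (Z ∩ {wa, p1}).card = 0 ∨ (Z ∩ {wb, p2}).card = 0 := by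
        by_contra hboth
        push Not at hboth
        obtain ⟨xa, hxa⟩ := Finset.card_pos.1 (Nat.pos_of_ne_zero hboth.1)
        obtain ⟨xb, hxb⟩ := Finset.card_pos.1 (Nat.pos_of_ne_zero hboth.2)
        rw [Finset.mem_inter, Finset.mem_insert, Finset.mem_singleton] at hxa hxb
        -- `xa ≠ xb`, both in `H_c`, so `Z ⊆ H_c ∌ w_c`
        have hxaC : xa ∈ clF M (R ∪ {wa, wb}) := by
          rcases hxa.2 with rfl | rfl; exacts [hwaC, hp1c]
        have hxbC : xb ∈ clF M (R ∪ {wa, wb}) := by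
          rcases hxb.2 with rfl | rfl; exacts [hwbC, hp2c]
        have hne : xa ≠ xb := by
          rintro rfl
          rcases hxa.2 with rfl | rfl <;> rcases hxb.2 with h | h
          · exact hab h
          · exact hp2.2.1 h.symm
          · exact hp1.2.2.1 h
          · exact hp12 h
        have hsub := subset_clF_pair_of_rkN_le_two hs hZg hZ hxa.1 hxb.1 hne
        have hZc : Z ⊆ clF M (R ∪ {wa, wb}) := hsub.trans (clF_subset_clF_of_subset_clF (by
          intro x hx; rw [Finset.mem_insert, Finset.mem_singleton] at hx
          rcases hx with rfl | rfl; exacts [hxaC, hxbC]))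
        exact hwcH (hZc hwc)
      omega
    · have hc0 : (Z ∩ {wc}).card = 0 := by
        rw [Finset.card_eq_zero, Finset.eq_empty_iff_forall_notMem]
        intro x hx
        rw [Finset.mem_inter, Finset.mem_singleton] at hx
        exact hwc (hx.2 ▸ hx.1)
      omega
  -- assemble
  have hZsub : Z ⊆ (Z ∩ R) ∪ (Z ∩ {wa, p1, wb, p2, wc}) := by
    intro x hx
    have hxT := hZT hx
    simp only [Finset.mem_insert, Finset.mem_union, Finset.mem_singleton] at hxT
    simp only [Finset.mem_union, Finset.mem_inter, Finset.mem_insert, Finset.mem_singleton]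
    rcases hxT with rfl | rfl | h | rfl | rfl | rfl
    · exact Or.inr ⟨hx, Or.inr (Or.inl rfl)⟩
    · exact Or.inr ⟨hx, Or.inr (Or.inr (Or.inr (Or.inl rfl)))⟩
    · exact Or.inl ⟨hx, h⟩
    · exact Or.inr ⟨hx, Or.inl rfl⟩
    · exact Or.inr ⟨hx, Or.inr (Or.inr (Or.inl rfl))⟩
    · exact Or.inr ⟨hx, Or.inr (Or.inr (Or.inr (Or.inr rfl)))⟩
  have := Finset.card_le_card hZsub
  have := Finset.card_union_le (Z ∩ R) (Z ∩ {wa, p1, wb, p2, wc})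
  omega

/-- The cardinality of the shape: `|T'| = |R| + 5`. -/
theorem card_shape {R : Finset α} {wa wb wc p1 p2 : α} (hwaR : wa ∉ R) (hwbR : wb ∉ R) (hwcR : wc ∉ R)
    (hab : wa ≠ wb) (hac : wa ≠ wc) (hbc : wb ≠ wc) (hp1 : p1 ∉ R ∪ {wa, wb, wc})
    (hp2 : p2 ∉ R ∪ {wa, wb, wc}) (hp12 : p1 ≠ p2) :
    (insert p1 (insert p2 (R ∪ {wa, wb, wc}))).card = R.card + 5 := by
  have h3 : ({wa, wb, wc} : Finset α).card = 3 := by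
    rw [Finset.card_insert_of_notMem, Finset.card_insert_of_notMem, Finset.card_singleton]
    · rw [Finset.mem_singleton]; exact hbc
    · rw [Finset.mem_insert, Finset.mem_singleton]; push Not; exact ⟨hab, hac⟩
  have hdisj : Disjoint R {wa, wb, wc} := by
    rw [Finset.disjoint_left]
    intro a haR ha
    rw [Finset.mem_insert, Finset.mem_insert, Finset.mem_singleton] at ha
    rcases ha with rfl | rfl | rfl
    · exact hwaR haR
    · exact hwbR haR
    · exact hwcR haR
  rw [Finset.card_insert_of_notMem, Finset.card_insert_of_notMem hp2, Finset.card_union_of_disjoint hdisj, h3]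
  rw [Finset.mem_insert]
  push Not
  exact ⟨hp12, hp1⟩

/-- **At most two coloops after deleting one point of the shape**: a subset `Y` of `T'` with one point fewer and
rank `5` has at most two coloops — three would leave `|R| + 1 ≥ 4` points of rank `2` outside `R`. -/
theorem card_coloops_le_two_of_shape (hs : ∀ e ∈ gr M, ∀ f ∈ gr M, e ≠ f → rkN M {e, f} = 2)
    {R : Finset α} {wa wb wc p1 p2 : α} (hRg : R ⊆ gr M) (hwag : wa ∈ gr M) (hwbg : wb ∈ gr M)
    (hwcg : wc ∈ gr M) (hp1g : p1 ∈ gr M) (hp2g : p2 ∈ gr M) (hR3 : 3 ≤ R.card)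
    (hwaR : wa ∉ R) (hwbR : wb ∉ R) (hwcR : wc ∉ R) (hab : wa ≠ wb) (hac : wa ≠ wc) (hbc : wb ≠ wc)
    (hp1 : p1 ∉ R ∪ {wa, wb, wc}) (hp2 : p2 ∉ R ∪ {wa, wb, wc}) (hp12 : p1 ≠ p2)
    (hwaH : wa ∉ clF M (R ∪ {wb, wc})) (hwbH : wb ∉ clF M (R ∪ {wa, wc})) (hwcH : wc ∉ clF M (R ∪ {wa, wb}))
    (hp1a : p1 ∉ clF M (R ∪ {wb, wc})) (hp1b : p1 ∈ clF M (R ∪ {wa, wc})) (hp1c : p1 ∈ clF M (R ∪ {wa, wb}))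
    (hp2b : p2 ∉ clF M (R ∪ {wa, wc})) (hp2a : p2 ∈ clF M (R ∪ {wb, wc})) (hp2c : p2 ∈ clF M (R ∪ {wa, wb}))
    {Y : Finset α} (hYT : Y ⊆ insert p1 (insert p2 (R ∪ {wa, wb, wc})))
    (hYcard : Y.card + 1 = (insert p1 (insert p2 (R ∪ {wa, wb, wc}))).card) (hY5 : rkN M Y = 5) :
    (coloops M Y).card ≤ 2 := by
  have hTg : insert p1 (insert p2 (R ∪ {wa, wb, wc})) ⊆ gr M := by
    intro a ha
    simp only [Finset.mem_insert, Finset.mem_union, Finset.mem_singleton] at ha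
    rcases ha with rfl | rfl | h | rfl | rfl | rfl
    · exact hp1g
    · exact hp2g
    · exact hRg h
    · exact hwag
    · exact hwbg
    · exact hwcg
  have hYg : Y ⊆ gr M := hYT.trans hTg
  rw [card_shape hwaR hwbR hwcR hab hac hbc hp1 hp2 hp12] at hYcard
  have hCY : coloops M Y ⊆ Y := fun a ha => (mem_coloops.1 ha).1
  have hrk := rkN_sdiff_add_card_of_subset_coloops (M := M) hYg (Finset.Subset.refl (coloops M Y))
  rw [hY5] at hrk
  have hcsd := Finset.card_sdiff_add_card_eq_card hCY
  by_contra hne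
  push Not at hne
  rcases Nat.lt_or_ge 3 (coloops M Y).card with h4 | h3
  · -- four or more coloops: the rest has rank `≤ 1`, hence at most one point
    have h1 := card_le_one_of_rkN_le_one hs (Finset.sdiff_subset.trans hYg)
      (show rkN M (Y \ coloops M Y) ≤ 1 by omega)
    omega
  · -- exactly three: the rest has `|R| + 1 ≥ 4` points of rank `2`
    have hc3 : (coloops M Y).card = 3 := by omega
    have hZT : Y \ coloops M Y ⊆ insert p1 (insert p2 (R ∪ {wa, wb, wc})) := Finset.sdiff_subset.trans hYT
    by_cases hZR : Y \ coloops M Y ⊆ R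
    · have := Finset.card_le_card hZR
      omega
    · have := card_le_three_of_rkN_le_two_of_shape hs hRg hwag hwbg hwcg hp1g hp2g hwaR hwbR hwcR hab hac hbc
        hp1 hp2 hp12 hwaH hwbH hwcH hp1a hp1b hp1c hp2b hp2a hp2c hZT (by omega) hZR
      omega

/-- **No distance-1 loss at a distance-2 target**: if `T` is a distance-2 target of a covered lossy big pair and
`T.erase y = insert z' B'` for a thin pair `(B', z')`, then `loss B' z' = 0`. -/
theorem loss_eq_zero_of_erase_mem_d2Targets (hG : G ∈ flatsQ M (5 + 1)) (hd : (gr M \ G).card = 2)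
    (hk : kColoops M G = 1) (hs : ∀ e ∈ gr M, ∀ f ∈ gr M, e ≠ f → rkN M {e, f} = 2)
    (hl : ∀ e ∈ gr M, M.Indep {e}) {B : Finset α} (hB : B ∈ thinMembers M 5 G)
    (hbig : 5 ≤ (B \ coloops M G).card) {z : α} (hz : z ∈ G \ clF M B) (h : loss M 5 G B z ≠ 0)
    (hno : ¬ (gtPts M 5 G (insert z B)).Nonempty) {T : Finset α} (hT : T ∈ d2Targets M 5 G (insert z B))
    {B' : Finset α} (hB' : B' ∈ thinMembers M 5 G) {z' : α} (hz' : z' ∈ G \ clF M B') {y : α} (hyT : y ∈ T)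
    (hy : T.erase y = insert z' B') : loss M 5 G B' z' = 0 := by
  have hd' : (gr M \ G).card ≤ 5 := by omega
  have hGg : G ⊆ gr M := (mem_flatsQ.1 hG).1
  obtain ⟨R, wa, wb, wc, p1, p2, hTK, hTG, -, hR3, hRG, hwaR, hwbR, hwcR, hab, hac, hbc, hp1, hp2, hp12,
    hp1G, hp2G, hwaG, hwbG, hwcG, hwaH, hwbH, hwcH, hp1a, hp1b, hp1c, hp2b, hp2a, hp2c⟩ :=
    d2Target_shape hG hd hk hs hl hB hbig hz h hno hT
  -- the set `insert z' B'` has rank `6`, its part off `K` rank `5`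
  have hB'G : B' ⊆ G := subset_G_of_mem_thinMembers hB'
  have hKB' : coloops M G ⊆ B' := coloops_subset_of_mem_thinMembers hG hd' hB'
  have hz'G : z' ∈ G := (Finset.mem_sdiff.1 hz').1
  have hQ'G : insert z' B' ⊆ G := Finset.insert_subset hz'G hB'G
  have hKQ' : coloops M G ⊆ insert z' B' := hKB'.trans (Finset.subset_insert _ _)
  have hrQ' : rkN M (insert z' B') = 6 := by
    rw [rkN_insert_of_notMem_clF (hGg hz'G) (Finset.mem_sdiff.1 hz').2, rkN_eq_five_of_mem_thinMembers hB']
  have hrY : rkN M (insert z' B' \ coloops M G) = 5 := by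
    have := rkN_eq_rkN_sdiff_add_one hG hk (S := insert z' B') hQ'G (Finset.Subset.refl _) hKQ'
    omega
  -- `y ∉ K`
  have hyK : y ∉ coloops M G := by
    intro hyK
    have : y ∈ T.erase y := hy ▸ hKQ' hyK
    exact (Finset.mem_erase.1 this).1 rfl
  -- `(insert z' B') ∖ K = (T ∖ K).erase y`
  have hYeq : insert z' B' \ coloops M G = (T \ coloops M G).erase y := by
    rw [← hy, Finset.erase_sdiff_comm]
  have hyTK : y ∈ T \ coloops M G := Finset.mem_sdiff.2 ⟨hyT, hyK⟩
  have hYT : insert z' B' \ coloops M G ⊆ insert p1 (insert p2 (R ∪ {wa, wb, wc})) := by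
    rw [hYeq, ← hTK]
    exact Finset.erase_subset _ _
  have hYcard : (insert z' B' \ coloops M G).card + 1 = (insert p1 (insert p2 (R ∪ {wa, wb, wc}))).card := by
    rw [hYeq, ← hTK, Finset.card_erase_of_mem hyTK]
    have := Finset.card_pos.2 ⟨y, hyTK⟩
    omega
  have hc2 := card_coloops_le_two_of_shape hs (hRG.trans hGg) (hGg hwaG) (hGg hwbG) (hGg hwcG) (hGg hp1G)
    (hGg hp2G) hR3 hwaR hwbR hwcR hab hac hbc hp1 hp2 hp12 hwaH hwbH hwcH hp1a hp1b hp1c hp2b hp2a hp2c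
    hYT hYcard hrY
  exact loss_eq_zero_of_card_coloops_le_two hG hd hk hQ'G hc2

/-- **`dshGT` sends nothing to a distance-2 target** of a covered lossy big pair. -/
theorem dshGT_eq_zero_of_mem_d2Targets (hG : G ∈ flatsQ M (5 + 1)) (hd : (gr M \ G).card = 2)
    (hk : kColoops M G = 1) (hs : ∀ e ∈ gr M, ∀ f ∈ gr M, e ≠ f → rkN M {e, f} = 2)
    (hl : ∀ e ∈ gr M, M.Indep {e}) {B : Finset α} (hB : B ∈ thinMembers M 5 G)
    (hbig : 5 ≤ (B \ coloops M G).card) {z : α} (hz : z ∈ G \ clF M B) (h : loss M 5 G B z ≠ 0)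
    (hno : ¬ (gtPts M 5 G (insert z B)).Nonempty) {T : Finset α} (hT : T ∈ d2Targets M 5 G (insert z B))
    {B' : Finset α} (hB' : B' ∈ thinMembers M 5 G) {z' : α} (hz' : z' ∈ G \ clF M B') :
    dshGT M 5 G B' z' T = 0 := by
  by_contra hne
  have hmem : T ∈ gtTargets M 5 G B' z' ∨ T ∈ missedTargets M G B' z' := by
    unfold dshGT dshMissed at hne
    split_ifs at hne with h1 h2 h3
    · exact Or.inl h2
    · exact absurd rfl hne
    · exact Or.inr h3
    · exact absurd rfl hne
  have hB'g : insert z' B' ⊆ gr M :=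
    (Finset.insert_subset (Finset.mem_sdiff.1 hz').1 (subset_G_of_mem_thinMembers hB')).trans
      (mem_flatsQ.1 hG).1
  obtain ⟨x, hxQ, hxT⟩ : ∃ x, x ∉ insert z' B' ∧ insert x (insert z' B') = T := by
    rcases hmem with hm | hm
    · unfold gtTargets at hm
      rw [Finset.mem_image] at hm
      obtain ⟨x, hx, rfl⟩ := hm
      simp only [gtPts, Finset.mem_filter, Finset.mem_sdiff] at hx
      exact ⟨x, hx.1.2, rfl⟩
    · obtain ⟨x, hx, hxz, rfl⟩ := mem_missedTargets.1 hm
      refine ⟨x, ?_, rfl⟩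
      rw [Finset.mem_insert]
      push Not
      exact ⟨hxz, fun hxB => (Finset.mem_sdiff.1 hx).2
        (subset_clF_of_subset_gr ((Finset.subset_insert _ _).trans hB'g) hxB)⟩
  have hy : T.erase x = insert z' B' := by
    rw [← hxT, Finset.erase_insert hxQ]
  exact hne (dshGT_eq_zero_of_loss_eq_zero
    (loss_eq_zero_of_erase_mem_d2Targets hG hd hk hs hl hB hbig hz h hno hT hB' hz'
      (hxT ▸ Finset.mem_insert_self x (insert z' B')) hy) T)

/-- **The `dshGT` load vanishes at a distance-2 target** of a covered lossy big pair: the whole `dshGT2` load there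
is its distance-2 part. -/
theorem dload_gt_eq_zero_of_mem_d2Targets (hG : G ∈ flatsQ M (5 + 1)) (hd : (gr M \ G).card = 2)
    (hk : kColoops M G = 1) (hs : ∀ e ∈ gr M, ∀ f ∈ gr M, e ≠ f → rkN M {e, f} = 2)
    (hl : ∀ e ∈ gr M, M.Indep {e}) {B : Finset α} (hB : B ∈ thinMembers M 5 G)
    (hbig : 5 ≤ (B \ coloops M G).card) {z : α} (hz : z ∈ G \ clF M B) (h : loss M 5 G B z ≠ 0)
    (hno : ¬ (gtPts M 5 G (insert z B)).Nonempty) {T : Finset α} (hT : T ∈ d2Targets M 5 G (insert z B)) :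
    dload M 5 G (bigP M G) (dshGT M 5 G) T = 0 := by
  unfold dload
  apply Finset.sum_eq_zero
  intro B' hB'
  apply Finset.sum_eq_zero
  intro z' hz'
  rw [Finset.mem_filter] at hB'
  exact dshGT_eq_zero_of_mem_d2Targets hG hd hk hs hl hB hbig hz h hno hT hB'.1 hz'

end PercRepro.Shadow
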